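/-
Copyright (c) 2026. All rights reserved.
Released under Apache 2.0 license as described in the file LICENSE.
Authors: abc-iut cell, prover seat abc-iut-w5-d112 (wave 5, gen 3; FACT-LIST exact-name closers).
-/
import Literature.IUT.LogVolume.TensorPacketLogHolds
import HarnessLib

/-!
# [IUTchIV] Proposition 1.2 (ii), (iii) — FACT-LIST rows F-2253 / F-2255 closed under their EXACT names

Mochizuki, *Inter-universal Teichmüller theory IV*, RIMS manuscript (Apr. 2020), §1, Prop. 1.2 (ii) p. 10 and
(iii) p. 11 [cite: Mochizuki2012, IUTchIV Prop 1.2 (ii) p.10] [cite: Mochizuki2012, IUTchIV Prop 1.2 (iii) p.11].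

PROOF-ONLY file (abc-iut cell, campaign S, FACT tranche 198 of plan/F-TRANCHES.tsv).  The FROZEN FACT-LIST rows
F-2253 `Literature.IUT.LogVolume.Prop12ii` and F-2255 `Literature.IUT.LogVolume.Prop12iii` (typed by abc-iut-S1 in
`TensorPacketRing.lean`) read «fact-open (reverted, R7 …)» only because the tree's proofs carry lower-camel names
(`prop12ii_holds`, `prop12iii_holds`, abc-iut-S6, `TensorPacketLogHolds.lean`, over abc-iut-S5's `prop11_holds` =
[IUTchIV] Prop. 1.1).  This file records the exact-name witnesses `Prop12ii_holds` / `Prop12iii_holds` as the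
UNIVERSAL CLOSURES over the statement's binders (the prime `p`, the finite index set `I`, the family of `p`-adic
fields `k`), so the R7 exact-name rule applies.  Nothing is assumed; nothing new is proved; no definition is added;
nothing here bears on [IUTchIII] Cor. 3.12 (these are the undisputed `p`-adic estimates of [IUTchIV] §1).
-/

noncomputable section

namespace Literature.IUT.LogVolume

/-- **F-2253 — [IUTchIV] Prop. 1.2 (ii) holds** (exact-name witness, universal closure over `p`, `I`, `k`):
`φ(p^λ·(R_I)^∼) ⊆ p^{⌊λ−d_I−a_I⌋}·log_p(R_I^×) ⊆ p^{⌊λ−d_I−a_I⌋−b_I}·(R_I)^∼` for every automorphism `φ` of the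
ℚ_p-vector space `⊗ k_i` stabilising the log-shell lattice, `|I| ≥ 2`.  BY NAME: abc-iut-S6's `prop12ii_holds`.
[cite: Mochizuki2012, IUTchIV Prop 1.2 (ii) p.10] [claim: Mochizuki2012, status: disputed] -/
theorem Prop12ii_holds : ∀ (p : ℕ) [Fact p.Prime] (I : Type) [Fintype I] [DecidableEq I] (k : I → Type)
    [∀ i, NontriviallyNormedField (k i)] [∀ i, NormedAlgebra ℚ_[p] (k i)] [∀ i, IsUltrametricDist (k i)]
    [∀ i, ProperSpace (k i)], Prop12ii p k := by
  intro p _ I _ _ k _ _ _ _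
  exact prop12ii_holds p k

/-- **F-2255 — [IUTchIV] Prop. 1.2 (iii) holds** (exact-name witness, universal closure over `p`, `I`, `k`):
for `p > 2` and `e_i ≤ p − 2`, `φ(p^λ·(R_I)^∼) ⊆ p^{λ−d_I−1}·(R_I)^∼`.  BY NAME: abc-iut-S6's `prop12iii_holds`.
[cite: Mochizuki2012, IUTchIV Prop 1.2 (iii) p.11] [claim: Mochizuki2012, status: disputed] -/
theorem Prop12iii_holds : ∀ (p : ℕ) [Fact p.Prime] (I : Type) [Fintype I] [DecidableEq I] (k : I → Type)
    [∀ i, NontriviallyNormedField (k i)] [∀ i, NormedAlgebra ℚ_[p] (k i)] [∀ i, IsUltrametricDist (k i)]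
    [∀ i, ProperSpace (k i)], Prop12iii p k := by
  intro p _ I _ _ k _ _ _ _
  exact prop12iii_holds p k

end Literature.IUT.LogVolume

end
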